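/-
Origin: expansion seat `planner-pub-hodgecm-toy-g3-0`, handover #2 2026-08-18T11:20:13Z (`HOME/pub-hodgecm-toy-g3/lean/ToyG3/OpenInputs3.lean`, md5 13c08f3d, 147 lines);
landed by the gen-8 packager in gate run 29 as `HodgeCM/Model/ToyG2/OpenInputs3.lean` (import ^import ToyG3\.CupFacts3[ \t]*$→import HodgeCM.Model.ToyG2.CupFacts3 ×1).
-/
/-
Copyright: pub-hodgecm formalisation cell (harness21, 2026). New file (not vendored).
Origin: session planner-pub-hodgecm-toy-g3-0 (unit pub-hodgecm-toy-g3, EXPANSION part (e) CONSISTENCY WITNESS, gen 3 of the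
lineage toy → toy-g2 → toy-g3), 2026-08-18.  WIP module `ToyG3.OpenInputs3`; intended final place
`HodgeCM/Model/ToyG2/OpenInputs3.lean` (module `HodgeCM.Model.ToyG2.OpenInputs3`; kind L5, toy model / consistency witness —
ONE NEW ADDITIVE FILE, no landed file is touched).  WIP import to rewrite on landing: `import ToyG3.CupFacts3` ↦
`import HodgeCM.Model.ToyG2.CupFacts3` (this seat, same handover); `HodgeCM.Model.ToyG2.ThetaModel3` is in the tree (gate run 27).
-/
import Mathlib
import Summits.HodgeConjecture.HodgeCM.Model.ToyG2.CupFacts3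
import Summits.HodgeConjecture.HodgeCM.Model.ToyG2.ThetaModel3

/-!
# The record of open inputs holds in the generation-2 toy universe `toyUniverse₃ d t`

`HodgeCM.Universe.OpenInputs` (StubTree/Inputs.lean) — `realisation_perL`, `realisation_face`, `pohlmann_span`,
`qw8_sufficiency` — is the hypothesis record of the package's headline theorems `HodgeCM.Assembly.COR_CM_of_openInputs`
(⇒ `HC_CM`) and `perL_of_openInputs` (⇒ `PerL`), to be supplied TOGETHER WITH `M : U.ModelAxioms` (referee A, G5).
Referee A's item G4 asks for a consistency witness of that hypothesis set.  State of the lineage so far: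

* generation 1 (`HodgeCM.Model.Toy`): `toyModel_modelAxioms` (28/28) but `¬ toyModel.OpenInputs` — the theta
  realisations are EMPTY there (all periods zero; `toyModel_openInputs_iff`, toy2-g2), so gen 1 witnesses
  `ModelAxioms ∧ PohlmannSpan ∧ Qw8Sufficiency ∧ ¬ RealisationExistsPerL ∧ ¬ RealisationExistsFace`;
* generation 2 (`HodgeCM.Model.ToyG2`): `toyUniverse₃ d t` (good objects, genuine trace, period leaves as Picard modular
  surfaces) has BOTH realisations for `1 ≤ d`, `t² = 16` (`ThetaUiso.realisationExistsPerL₃ / Face₃`, pv03-g5) and 27 of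
  the 28 model axioms outright (`toyUniverse₃_modelAxioms_of_gysin`; the 28th, M26 Gysin for good surfaces, is toy-g2's
  `SplitInput` programme, closed by pv03-g6's `toyUniverse₃_modelAxioms_all`, `HodgeCM.Model.ToyG2.SplitAllGood`).

This file closes the square: with `HodgeCM.Model.ToyG2.CupFacts3` (Pohlmann's theorem and [QW8] sufficiency in
`toyModel3With`), **all four open inputs hold in `toyUniverse₃ d t` under its model axioms** —

* `toyUniverse₃_openInputs (M) (hd) (ht) : (toyUniverse₃ d t).OpenInputs`;
* `toyUniverse₃_modelAxioms_and_openInputs_of_gysin`, `exists_modelAxioms_and_openInputs_of_gysin` — the JOINT witness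
  `∃ U, U.ModelAxioms ∧ U.OpenInputs` modulo the one displayed axiom M26 of `Universe3` (discharged in
  `HodgeCM.Model.ToyG2.OpenInputsAll3` from `SplitAllGood`);
* `toyUniverse₃_headline (M) (hd) (ht)` — the package's two headline theorems RUN on the model: `HC_CM` by
  `Assembly.COR_CM_of_openInputs` and `PerL` by `Assembly.perL_of_openInputs`, together with `PeriodThmF` and `W_RK4`;
* `toyUniverse₃_profile (M) (hd) (ht)` — the truth table: every statement of the headline cone (`OpenInputs` field by
  field, `PohlmannBasis`, `PohlmannTheorem31`, `HC_CM`, `PerL`, `PeriodThmF`, `W_RK4`, `FaceReduction`, `Lemma81`) is TRUE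
  in `toyUniverse₃ d t` — compare `HodgeCM.Toy.toyModel_profile`, where the whole realisation side is FALSE.

WHAT THIS SHOWS / DOES NOT SHOW.  It shows that the hypothesis set `ModelAxioms ∧ OpenInputs` of the headline theorems
is satisfiable (mod M26 here; outright in `OpenInputsAll3`) by ONE explicit structure in which nothing degenerates
(nonzero periods, nonempty theta sets, `alg = ` Hodge classes with Pohlmann's basis theorem a kernel theorem of the model),
so no input is refutable from the others and the headline theorems are not vacuously true.  It says nothing about the
intended universe of complex projective varieties: there the two realisation inputs remain OPEN (they are the things
under adjudication), and `PohlmannSpan` / `Qw8Sufficiency` are cited / reduced to standard facts elsewhere in the package.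
Everything here is kernel-proved from the tree; no citation, nothing posited.
-/

noncomputable section

namespace HodgeCM.ToyG2

open HodgeCM.Toy
open Literature.AlgebraicGeometry.Motives (CMType)

variable (d t : ℚ)

/-! ### The four open inputs in `toyUniverse₃ d t` -/

/-- `PohlmannSpan` in `toyUniverse₃ d t` (given its model axioms). -/
theorem toyUniverse₃_pohlmannSpan (M : (toyUniverse₃ d t).ModelAxioms) : (toyUniverse₃ d t).PohlmannSpan :=
  toyModel3_pohlmannSpan M

/-- `PohlmannBasis` in `toyUniverse₃ d t` (given its model axioms). -/
theorem toyUniverse₃_pohlmannBasis (M : (toyUniverse₃ d t).ModelAxioms) : (toyUniverse₃ d t).PohlmannBasis :=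
  toyModel3_pohlmannBasis M

/-- `PohlmannTheorem31` in `toyUniverse₃ d t` (given its model axioms). -/
theorem toyUniverse₃_pohlmannTheorem31 (M : (toyUniverse₃ d t).ModelAxioms) :
    (toyUniverse₃ d t).PohlmannTheorem31 :=
  toyModel3_pohlmannTheorem31 M

/-- `Qw8Sufficiency` in `toyUniverse₃ d t` (given its model axioms). -/
theorem toyUniverse₃_qw8Sufficiency (M : (toyUniverse₃ d t).ModelAxioms) : (toyUniverse₃ d t).Qw8Sufficiency :=
  toyModel3_qw8Sufficiency M

variable (hd : (1 : ℚ) ≤ d) (ht : t ^ 2 = 16)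
include hd ht

/-- **All four open inputs hold in `toyUniverse₃ d t`** (`1 ≤ d`, `t² = 16`; given its model axioms): the two theta
realisations are pv03-g5's `realisationExistsPerL₃ / Face₃` (`ThetaModel3`), the two CM-side inputs are
`CupFacts3`'s `toyModel3_pohlmannSpan / qw8Sufficiency`. -/
theorem toyUniverse₃_openInputs (M : (toyUniverse₃ d t).ModelAxioms) : (toyUniverse₃ d t).OpenInputs where
  realisation_perL := ThetaUiso.realisationExistsPerL₃ d t hd ht
  realisation_face := ThetaUiso.realisationExistsFace₃ d t hd ht
  pohlmann_span := toyModel3_pohlmannSpan M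
  qw8_sufficiency := toyModel3_qw8Sufficiency M

omit hd ht in
/-- In `toyUniverse₃ d t` (any `d`, `t`; given its model axioms) the record of open inputs is equivalent to the
conjunction of the two realisation statements (`CupFacts3`'s `toyModel3_openInputs_iff`). -/
theorem toyUniverse₃_openInputs_iff (M : (toyUniverse₃ d t).ModelAxioms) :
    (toyUniverse₃ d t).OpenInputs ↔
      ((toyUniverse₃ d t).RealisationExistsPerL ∧ (toyUniverse₃ d t).RealisationExistsFace) :=
  toyModel3_openInputs_iff M

/-! ### The joint consistency witness, modulo M26 -/

/-- **`ModelAxioms ∧ OpenInputs` for `toyUniverse₃ d t`, GIVEN M26** (Gysin for the good surfaces of the universe;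
the other 27 model axioms are theorems of toy-g2's `Universe3`). -/
theorem toyUniverse₃_modelAxioms_and_openInputs_of_gysin (h26 : (toyUniverse₃ d t).Fact_gysin_surface) :
    (toyUniverse₃ d t).ModelAxioms ∧ (toyUniverse₃ d t).OpenInputs :=
  have M := toyUniverse₃_modelAxioms_of_gysin d t h26
  ⟨M, toyUniverse₃_openInputs d t hd ht M⟩

omit hd ht in
/-- **The joint G4 witness modulo M26**: `∃ U, U.ModelAxioms ∧ U.OpenInputs`, at `d = 1`, `t = 4`, GIVEN M26 for
`toyUniverse₃ 1 4` (discharged in `HodgeCM.Model.ToyG2.OpenInputsAll3`). -/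
theorem exists_modelAxioms_and_openInputs_of_gysin (h26 : (toyUniverse₃ 1 4).Fact_gysin_surface) :
    ∃ U : Universe, U.ModelAxioms ∧ U.OpenInputs :=
  ⟨toyUniverse₃ 1 4, toyUniverse₃_modelAxioms_and_openInputs_of_gysin 1 4 le_rfl (by norm_num) h26⟩

/-! ### The headline theorems run on the model -/

/-- **The package's headline theorems applied to `toyUniverse₃ d t`** (given its model axioms): COR-CM
(`Assembly.COR_CM_of_openInputs`: `HC_CM`, the Hodge conjecture for the CM abelian varieties OF THE MODEL — where
`alg =` Hodge classes, so the content is that the kernel proof term runs), PerL (`Assembly.perL_of_openInputs`),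
rfwf Thm 4.1 (`Assembly.periodThmF`) and `W^{RK4}` (`Assembly.w_rk4`). -/
theorem toyUniverse₃_headline (M : (toyUniverse₃ d t).ModelAxioms) :
    (toyUniverse₃ d t).HC_CM ∧ (toyUniverse₃ d t).PerL ∧ (toyUniverse₃ d t).PeriodThmF ∧ (toyUniverse₃ d t).W_RK4 :=
  have I := toyUniverse₃_openInputs d t hd ht M
  ⟨Assembly.COR_CM_of_openInputs _ M I, Assembly.perL_of_openInputs _ M I,
    Assembly.periodThmF _ M I.realisation_face, Assembly.w_rk4 _ M I.realisation_face⟩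

/-- **Truth table of `toyUniverse₃ d t`** (`1 ≤ d`, `t² = 16`; given its model axioms): every statement in the cone
of the headline theorems is TRUE — the four open inputs, Pohlmann's theorem in its three typed forms, and the five
headline-side statements.  (In generation 1, `HodgeCM.Toy.toyModel_profile`, the six realisation-side entries are
FALSE.) -/
theorem toyUniverse₃_profile (M : (toyUniverse₃ d t).ModelAxioms) :
    (toyUniverse₃ d t).OpenInputs ∧
      ((toyUniverse₃ d t).RealisationExistsPerL ∧ (toyUniverse₃ d t).RealisationExistsFace ∧
        (toyUniverse₃ d t).PohlmannSpan ∧ (toyUniverse₃ d t).PohlmannBasis ∧ (toyUniverse₃ d t).PohlmannTheorem31 ∧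
        (toyUniverse₃ d t).Qw8Sufficiency) ∧
      ((toyUniverse₃ d t).HC_CM ∧ (toyUniverse₃ d t).PerL ∧ (toyUniverse₃ d t).PeriodThmF ∧
        (toyUniverse₃ d t).W_RK4 ∧ (toyUniverse₃ d t).FaceReduction ∧ (toyUniverse₃ d t).Lemma81) :=
  have I := toyUniverse₃_openInputs d t hd ht M
  have H := toyUniverse₃_headline d t hd ht M
  ⟨I, ⟨I.realisation_perL, I.realisation_face, I.pohlmann_span, toyModel3_pohlmannBasis M,
      toyModel3_pohlmannTheorem31 M, I.qw8_sufficiency⟩,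
    ⟨H.1, H.2.1, H.2.2.1, H.2.2.2, StubTree.faceReduction_holds _ I.pohlmann_span I.qw8_sufficiency,
      StubTree.lemma81_holds _ M⟩⟩

end HodgeCM.ToyG2

end
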